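import Summits.HubbardSuperconductivity.HubbardSuperconductivity.Theses.DeformationLadder
import Literature.MathematicalPhysics.QuantumLattice.LiebFluxPhaseGauge
import Summits.HubbardSuperconductivity.HubbardSuperconductivity.Theorems.DeformationLadderLadderThesisPinnedFrameBloch
import Summits.HubbardSuperconductivity.HubbardSuperconductivity.Theorems.DeformationLadderLadderThesisRigidityReduction

/-!
# Evidence — the sketch's `CondensateBloch` (line `Sketch`, crux stmt-HubbardSuperconductivity-1890) holds
# VERBATIM, vacuously

The definitions `twistAngle`, `upTwistPhase`, `upTwist`, `kOne`, `CondensateBloch` below are copied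
byte-for-byte from `Cruxes/LadderThesis/SketchIdeator2.lean` (namespace, `variable` line and all; the Cruxes
module itself is not an importable build target on the farm), and `condensateBloch_holds : CondensateBloch`
is proved with the witnesses `γ := σ/32`, `L₀ := 0`: the right-hand side is `Re⟨D φ, H D φ⟩ - E₀ ≥ 0`
(`D = upTwist L kOne` is a norm-one diagonal gauge transformation, hence maps the sector to itself
isometrically; variational principle) and the left-hand side is `≤ 32γ - σ = 0` by
`re_expect_pairPenalty_le`.  So the card's "one missing inequality, in its sharpest dress" constrains nothing
as typed; see `Theorems/DeformationLadderLadderThesisStubCondensateBloch.lean` (p96131) for the same fact on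
the registered stub in tree vocabulary, and `Lines/Sketch.dead.md`.
-/

noncomputable section

namespace Summit.HubbardSuperconductivity.HubbardSuperconductivity.Cruxes.LadderThesis.PinnedFrame

set_option linter.dupNamespace false

open Literature.MathematicalPhysics.QuantumLattice Literature.Probability.LatticeModels Matrix
open Summit.HubbardSuperconductivity.HubbardSuperconductivity.Theses.DeformationLadder
open Summit.HubbardSuperconductivity.HubbardSuperconductivity.Theorems.PinnedFrame (star_mulVec_dotProduct)
open scoped ComplexOrder BigOperators

/-! ### Two generic facts about norm-one gauge transformations `orbitalPhase g` on vectors -/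

section OrbitalPhaseVec

variable {ι : Type*} [LinearOrder ι] [Fintype ι]

/-- Action on vectors: `(D_g ψ)(s) = (∏_{i ∈ s} g i) · ψ(s)`. [folklore] -/
theorem orbitalPhase_mulVec_apply (g : ι → ℂ) (ψ : Fock ι) (s : Finset ι) :
    (orbitalPhase g *ᵥ ψ) s = (∏ i ∈ s, g i) * ψ s := by
  rw [orbitalPhase, mulVec_diagonal]

/-- `D_gᴴ (D_g v) = v` for norm-one phases. [folklore] -/
theorem conjTranspose_orbitalPhase_mulVec_mulVec {g : ι → ℂ} (hg : ∀ i, ‖g i‖ = 1) (v : Fock ι) :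
    (orbitalPhase g)ᴴ *ᵥ (orbitalPhase g *ᵥ v) = v := by
  rw [mulVec_mulVec, conjTranspose_orbitalPhase_mul hg, one_mulVec]

end OrbitalPhaseVec

variable (L : ℕ) [NeZero L]

/-- [verbatim from SketchIdeator2.lean] The flat-twist angle `(2π/L) Σ_i k_i x_i`. -/
def twistAngle (k x : TorusSite 2 L) : ℝ :=
  2 * Real.pi / L * ∑ i : Fin 2, ((k i).val : ℝ) * ((x i).val : ℝ)

/-- [verbatim from SketchIdeator2.lean] Orbital phases of the spin-↑ flat gauge transformation. -/
def upTwistPhase (k : TorusSite 2 L) : Orb (FermionTorus 2 L) → ℂ := fun o =>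
  if (ofLex o).2 = 0 then
    Complex.exp (-(Complex.I * (twistAngle L k (FermionTorus.toTorusSite (ofLex o).1) : ℂ)))
  else 1

/-- [verbatim from SketchIdeator2.lean] `D_k`, a diagonal unitary of Fock space. -/
def upTwist (k : TorusSite 2 L) :
    Matrix (Finset (Orb (FermionTorus 2 L))) (Finset (Orb (FermionTorus 2 L))) ℂ :=
  orbitalPhase (upTwistPhase L k)

/-- [verbatim from SketchIdeator2.lean] The first nonzero pair momentum `k₁ = (1, 0)`. -/
def kOne : TorusSite 2 L := fun i => if i = 0 then 1 else 0

/-- [verbatim from SketchIdeator2.lean] (f) **Condensate-improved Bloch inequality** — the card's proposed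
load-bearing statement. -/
def CondensateBloch : Prop :=
  ∀ (U : ℝ), 0 < U → ∀ δ ∈ Set.Ioo (0:ℝ) (1 / 2), ∀ σ : ℝ, 0 < σ → ∃ γ : ℝ, 0 < γ ∧ ∃ L₀ : ℕ,
    ∀ (L : ℕ) [NeZero L], L₀ ≤ L → Even L →
      ∀ φ : Fock (Orb (FermionTorus 2 L)),
        φ ∈ szSector (2 * ⌊(1 - δ) * (L : ℝ) ^ 2 / 2⌋₊) 0 → star φ ⬝ᵥ φ = 1 →
          γ * ((expect ((pairField dWaveFormFactor L)ᴴ * pairField dWaveFormFactor L) φ).re / (L : ℝ) ^ 4) - σ ≤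
            ((expect (hubbardTorus 2 L 1 U) φ).re -
                (hubbardTorus 2 L 1 U).minEnergyOn (szSector (2 * ⌊(1 - δ) * (L : ℝ) ^ 2 / 2⌋₊) 0)) +
              (expect ((upTwist L (kOne L))ᴴ * hubbardTorus 2 L 1 U * upTwist L (kOne L) -
                  hubbardTorus 2 L 1 U) φ).re

/-! ### The proof -/

omit [NeZero L] in
/-- The gauge phases have modulus one. -/
theorem norm_upTwistPhase (k : TorusSite 2 L) (o : Orb (FermionTorus 2 L)) : ‖upTwistPhase L k o‖ = 1 := by
  unfold upTwistPhase
  split_ifs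
  · rw [show -(Complex.I * (twistAngle L k (FermionTorus.toTorusSite (ofLex o).1) : ℂ)) =
        ((-(twistAngle L k (FermionTorus.toTorusSite (ofLex o).1)) : ℝ) : ℂ) * Complex.I by
          push_cast; ring]
    exact Complex.norm_exp_ofReal_mul_I _
  · simp

omit [NeZero L] in
/-- Action of the gauge transformation on vectors: `(D ψ)(s) = (∏_{i∈s} g i) ψ(s)`. -/
theorem upTwist_mulVec_apply (k : TorusSite 2 L) (ψ : Fock (Orb (FermionTorus 2 L)))
    (s : Finset (Orb (FermionTorus 2 L))) :
    (upTwist L k *ᵥ ψ) s = (∏ i ∈ s, upTwistPhase L k i) * ψ s :=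
  orbitalPhase_mulVec_apply _ ψ s

omit [NeZero L] in
/-- `D` maps every joint sector `(N, S^z = M)` into itself (it is diagonal in the occupation basis). -/
theorem upTwist_mulVec_mem_szSector (k : TorusSite 2 L) {N : ℕ} {M : ℝ}
    {ψ : Fock (Orb (FermionTorus 2 L))} (h : ψ ∈ szSector N M) : upTwist L k *ᵥ ψ ∈ szSector N M := by
  rw [mem_szSector_iff] at h ⊢
  obtain ⟨hN, hZ⟩ := h
  refine ⟨fun s hs => by rw [upTwist_mulVec_apply, hN s hs, mul_zero], ?_⟩
  funext s
  have hs := congrFun hZ s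
  rw [LiebThm1.spinZ_mulVec_apply, Pi.smul_apply, smul_eq_mul] at hs ⊢
  rw [upTwist_mulVec_apply, mul_left_comm, hs, mul_left_comm]

omit [NeZero L] in
/-- `D` is an isometry on vectors: `Dᴴ (D v) = v`. -/
theorem conjTranspose_upTwist_mulVec_mulVec (k : TorusSite 2 L) (v : Fock (Orb (FermionTorus 2 L))) :
    (upTwist L k)ᴴ *ᵥ (upTwist L k *ᵥ v) = v :=
  conjTranspose_orbitalPhase_mulVec_mulVec (norm_upTwistPhase L k) v

omit [NeZero L] in
/-- Bloch's variational inequality in the sketch's frame: `E₀ ≤ Re⟨ψ, Dᴴ H D ψ⟩` on every joint sector. -/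
theorem minEnergyOn_le_re_upTwist_frame (U : ℝ) (k : TorusSite 2 L) {N : ℕ} {M : ℝ}
    {ψ : Fock (Orb (FermionTorus 2 L))} (hψ : ψ ∈ szSector N M) (hψ1 : star ψ ⬝ᵥ ψ = 1) :
    (hubbardTorus 2 L 1 U).minEnergyOn (szSector N M) ≤
      (star ψ ⬝ᵥ (((upTwist L k)ᴴ * hubbardTorus 2 L 1 U * upTwist L k) *ᵥ ψ)).re := by
  have hmem : upTwist L k *ᵥ ψ ∈ szSector N M := upTwist_mulVec_mem_szSector L k hψ
  have h1 : star (upTwist L k *ᵥ ψ) ⬝ᵥ (upTwist L k *ᵥ ψ) = 1 := by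
    rw [star_mulVec_dotProduct, conjTranspose_upTwist_mulVec_mulVec, hψ1]
  have h := minEnergyOn_le_rayleigh_of_mem
    (LiebThm1.hamiltonian_isHermitian (fermionTorusGraph 2 L) 1 U) _ hmem h1
  rwa [Matrix.star_mulVec_dotProduct_mulVec] at h

omit L [NeZero L] in
/-- **The sketch's `CondensateBloch` holds, vacuously** (`γ := σ/32`, `L₀ := 0`). -/
theorem condensateBloch_holds : CondensateBloch := by
  intro U _hU δ _hδ σ hσ
  refine ⟨σ / 32, by positivity, 0, ?_⟩
  intro L _ _hL _hE φ hφ hφ1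
  have hL0 : (0 : ℝ) < L := Nat.cast_pos.mpr (Nat.pos_of_ne_zero (NeZero.ne L))
  have hL4 : (0 : ℝ) < (L : ℝ) ^ 4 := by positivity
  have hlro : (expect ((pairField dWaveFormFactor L)ᴴ * pairField dWaveFormFactor L) φ).re /
      (L : ℝ) ^ 4 ≤ 32 := by
    rw [div_le_iff₀ hL4]
    exact Theorems.DeformationLadder.re_expect_pairPenalty_le L hφ1
  have hframe := minEnergyOn_le_re_upTwist_frame L U (kOne L) hφ hφ1
  have hexp : (expect ((upTwist L (kOne L))ᴴ * hubbardTorus 2 L 1 U * upTwist L (kOne L) -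
        hubbardTorus 2 L 1 U) φ).re =
      (star φ ⬝ᵥ (((upTwist L (kOne L))ᴴ * hubbardTorus 2 L 1 U * upTwist L (kOne L)) *ᵥ φ)).re -
        (expect (hubbardTorus 2 L 1 U) φ).re := by
    simp only [expect, sub_mulVec, dotProduct_sub, Complex.sub_re]
  rw [hexp]
  have hγ : σ / 32 * ((expect ((pairField dWaveFormFactor L)ᴴ * pairField dWaveFormFactor L) φ).re /
      (L : ℝ) ^ 4) ≤ σ / 32 * 32 := mul_le_mul_of_nonneg_left hlro (by positivity)
  linarith

end Summit.HubbardSuperconductivity.HubbardSuperconductivity.Cruxes.LadderThesis.PinnedFrame
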